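import Mathlib
import Summits.ValiantsHypothesis.ValiantsHypothesis.Theorems.ValuativeGCTValuativeFlipSlidingWindows

/-!
# Per-stratum rank bound, Left-multiplied strata (crux `ValuativeGCT.ValuativeFlip`, stub `stub_fourRowPencilRank`)

P4-SIMPLE, L side, of the cyclic-tridiagonal architecture for hypothesis `H` of
`fourRowPencilRank_of_pencilCertificate` (`Cruxes/ValuativeFlip/AxisK9G1a2CyclicTridiagonal.md` §5b);
mirror of `…StrataRankR`.  Fix a field `K`, `n = e + k + 1` with `2 ≤ e`, `1 ≤ k`, and injective
`α γ : ZMod n → K`.  The bottom components of the Left-multiplied generators of string length `e`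
are the `4n` products

  `slGen q o t = y_t · P_{q+2o} · R_q`,  `P_q = swW α 0 1 e q`,  `R_q = swW γ 2 3 k (q+e+1)`

(`o t : Fin 2`; multipliers `y₀, y₁`).

* `sl_finrank_span_ge` — **`4n - 2(e+2) ≤ finrank (span (range slGen))`.**

Proof: substituting `y₀ ↦ α_w, y₁ ↦ 1` (`slEv w`) turns a relation into
`Σ_q A_q(w) • R_q = 0`, `A_q(w) = slA c q w`, with `A_q(w) = 0` unless `q ∈ [w-1, w+k+1]`
(`α_w` is a common root of `P_q`, `P_{q+2}` otherwise), a relation among `k + 3` consecutive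
windows `R_q`; recording `A_{w+k}(w), A_{w+k+1}(w)` for `e + 2` values `w` is injective on the
kernel (`sw_coeff_eq_zero_of_sum_eq_zero_of_top_two` for the `R`-windows, then the univariate
polynomial `slPoly c q` of degree `≤ e+1` has `e+2` roots, and its coefficients are read off at
`α_{q+e}, α_{q+e+1}`, roots of `P_{q+2}` but not of `P_q`). [this crux; new]
-/

set_option linter.dupNamespace false

namespace Summit.ValiantsHypothesis.ValiantsHypothesis.Theorems.ValuativeFlip

open MvPolynomial
open scoped BigOperators

noncomputable section

/-- The Left multiplier `y_t`: `X 0` for `t = 0`, `X 1` for `t = 1`. [this crux] -/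
def slMul {K : Type*} [Field K] (t : Fin 2) : MvPolynomial (Fin 4) K := if t = 0 then X 0 else X 1

/-- The `4n` Left-multiplied stratum generators `y_t · P_{q+2o} · R_q`. [this crux] -/
def slGen {K : Type*} [Field K] {n : ℕ} (α γ : ZMod n → K) (e k : ℕ)
    (i : ZMod n × Fin 2 × Fin 2) : MvPolynomial (Fin 4) K :=
  slMul i.2.2 * swW α 0 1 e (i.1 + 2 * ((i.2.1 : ℕ) : ZMod n)) *
    swW γ 2 3 k (i.1 + ((e + 1 : ℕ) : ZMod n))

/-- The substitution `y₀ ↦ α_w`, `y₁ ↦ 1` (Right variables untouched). [this crux] -/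
def slEv {K : Type*} [Field K] {n : ℕ} (α : ZMod n → K) (w : ZMod n) :
    MvPolynomial (Fin 4) K →ₐ[K] MvPolynomial (Fin 4) K :=
  aeval fun i : Fin 4 => if i = 0 then C (α w) else if i = 1 then 1 else X i

/-- Value of the multiplier `y_t` under `slEv w`: `α_w` or `1`. [this crux] -/
def slMulVal {K : Type*} [Field K] {n : ℕ} (α : ZMod n → K) (t : Fin 2) (w : ZMod n) : K :=
  if t = 0 then α w else 1

/-- Value of the Left window `P_p = ∏_{s<e} (y₀ - α_{p+s} y₁)` at `(α_w, 1)`. [this crux] -/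
def slPVal {K : Type*} [Field K] {n : ℕ} (α : ZMod n → K) (e : ℕ) (p w : ZMod n) : K :=
  ∏ s ∈ Finset.range e, (α w - α (p + s))

/-- The coefficient `A_q(w)` of `R_q` after the substitution `slEv w` in the combination with
weights `c`. [this crux] -/
def slA {K : Type*} [Field K] {n : ℕ} (α : ZMod n → K) (e : ℕ)
    (c : ZMod n × Fin 2 × Fin 2 → K) (q w : ZMod n) : K :=
  (∑ t : Fin 2, c (q, 0, t) * slMulVal α t w) * slPVal α e q w +
    (∑ t : Fin 2, c (q, 1, t) * slMulVal α t w) * slPVal α e (q + 2) w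

/-- The univariate polynomial `A_q(x) = μ_q(x) P_q(x) + μ'_q(x) P_{q+2}(x)` (dehomogenised at
`y₁ = 1`), whose value at `α_w` is `slA c q w`. [this crux] -/
def slPoly {K : Type*} [Field K] {n : ℕ} (α : ZMod n → K) (e : ℕ)
    (c : ZMod n × Fin 2 × Fin 2 → K) (q : ZMod n) : Polynomial K :=
  (Polynomial.C (c (q, 0, 0)) * Polynomial.X + Polynomial.C (c (q, 0, 1))) *
      ∏ s ∈ Finset.range e, (Polynomial.X - Polynomial.C (α (q + s))) +
    (Polynomial.C (c (q, 1, 0)) * Polynomial.X + Polynomial.C (c (q, 1, 1))) *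
      ∏ s ∈ Finset.range e, (Polynomial.X - Polynomial.C (α (q + 2 + s)))

section lemmas

variable {K : Type*} [Field K] {n : ℕ}

/-- `slEv w` fixes the Right windows `R_q`. [this crux] -/
theorem slEv_swW_right (α γ : ZMod n → K) (w : ZMod n) (k : ℕ) (p : ZMod n) :
    slEv α w (swW γ 2 3 k p) = swW γ 2 3 k p := by
  unfold slEv swW; rw [map_prod]
  refine Finset.prod_congr rfl fun s _ => ?_
  simp

/-- `slEv w` sends the Left window `P_p` to the constant `slPVal`. [this crux] -/
theorem slEv_swW_left (α : ZMod n → K) (w : ZMod n) (e : ℕ) (p : ZMod n) :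
    slEv α w (swW α 0 1 e p) = MvPolynomial.C (slPVal α e p w) := by
  unfold slEv swW slPVal; rw [map_prod, map_prod]
  refine Finset.prod_congr rfl fun s _ => ?_
  simp

/-- `slEv w` sends the multiplier `y_t` to the constant `slMulVal`. [this crux] -/
theorem slEv_slMul (α : ZMod n → K) (w : ZMod n) (t : Fin 2) :
    slEv α w (slMul t) = MvPolynomial.C (slMulVal α t w) := by
  unfold slEv slMul slMulVal
  fin_cases t <;> simp

/-- `slEv w` of a generator: `R_q` times a constant. [this crux] -/
theorem slEv_slGen (α γ : ZMod n → K) (e k : ℕ) (w : ZMod n) (i : ZMod n × Fin 2 × Fin 2) :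
    slEv α w (slGen α γ e k i) =
      MvPolynomial.C (slMulVal α i.2.2 w * slPVal α e (i.1 + 2 * ((i.2.1 : ℕ) : ZMod n)) w) *
        swW γ 2 3 k (i.1 + ((e + 1 : ℕ) : ZMod n)) := by
  unfold slGen
  rw [map_mul, map_mul, slEv_slMul, slEv_swW_left, slEv_swW_right, map_mul]

/-- **The substituted relation, regrouped by Right window**:
`slEv w (Σ_i c i • slGen i) = Σ_q slA c q w • R_q`. [this crux] -/
theorem slEv_linearCombination [NeZero n] (α γ : ZMod n → K) (e k : ℕ) (w : ZMod n)
    (c : ZMod n × Fin 2 × Fin 2 → K) :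
    slEv α w (Fintype.linearCombination K (slGen α γ e k) c) =
      ∑ q : ZMod n, slA α e c q w • swW γ 2 3 k (q + ((e + 1 : ℕ) : ZMod n)) := by
  rw [Fintype.linearCombination_apply, map_sum]
  simp_rw [map_smul, slEv_slGen]
  rw [Fintype.sum_prod_type]
  refine Finset.sum_congr rfl fun q _ => ?_
  simp only [Fintype.sum_prod_type, Fin.sum_univ_two, slA, Fin.val_zero, Fin.val_one,
    Nat.cast_zero, Nat.cast_one, mul_zero, add_zero, mul_one, smul_eq_C_mul, map_add, map_mul]
  ring

/-- `slA` is additive in the weights. [this crux] -/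
theorem slA_add (α : ZMod n → K) (e : ℕ) (c d : ZMod n × Fin 2 × Fin 2 → K) (q w : ZMod n) :
    slA α e (c + d) q w = slA α e c q w + slA α e d q w := by
  simp only [slA, Pi.add_apply, Fin.sum_univ_two]
  ring

/-- `slA` is homogeneous in the weights. [this crux] -/
theorem slA_smul (α : ZMod n → K) (e : ℕ) (r : K) (c : ZMod n × Fin 2 × Fin 2 → K)
    (q w : ZMod n) : slA α e (r • c) q w = r * slA α e c q w := by
  simp only [slA, Pi.smul_apply, smul_eq_mul, Fin.sum_univ_two]
  ring

/-- Index bookkeeping: every `q : ZMod n` is `w - 1 + t` for a unique `t < n`. [this crux] -/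
theorem zmod_exists_offset' [NeZero n] (w q : ZMod n) :
    ∃ t : ℕ, t < n ∧ q = w - 1 + t := by
  refine ⟨(q - (w - 1)).val, ZMod.val_lt _, ?_⟩
  rw [ZMod.natCast_zmod_val]; ring

/-- **Support of the coefficients**: `slA c q w = 0` unless `q = w - 1 + t` with `t ≤ k + 2`
(otherwise `α_w` is a root of both `P_q` and `P_{q+2}`).  Needs `n = e + k + 1`. [this crux] -/
theorem slA_support [NeZero n] (α : ZMod n → K) {e k : ℕ} (hn : n = e + k + 1)
    (c : ZMod n × Fin 2 × Fin 2 → K) (w q : ZMod n) (hq : slA α e c q w ≠ 0) :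
    ∃ t : ℕ, t ≤ k + 2 ∧ q = w - 1 + t := by
  obtain ⟨t, htn, rfl⟩ := zmod_exists_offset' w q
  refine ⟨t, ?_, rfl⟩
  by_contra hgt
  rw [not_le] at hgt
  apply hq
  unfold slA
  -- `α_w` is the root of index `n + 1 - t` of `P_q` and of index `n - 1 - t` of `P_{q+2}`
  have h1 : slPVal α e (w - 1 + t) w = 0 := by
    unfold slPVal
    apply Finset.prod_eq_zero (i := n + 1 - t) (Finset.mem_range.mpr (by omega))
    rw [sub_eq_zero]; congr 1
    have hc1 : ((n + 1 - t : ℕ) : ZMod n) = 1 - (t : ZMod n) := by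
      rw [Nat.cast_sub (by omega), Nat.cast_add, Nat.cast_one, ZMod.natCast_self]
      ring
    rw [hc1]
    ring
  have h2 : slPVal α e (w - 1 + t + 2) w = 0 := by
    unfold slPVal
    apply Finset.prod_eq_zero (i := n - 1 - t) (Finset.mem_range.mpr (by omega))
    rw [sub_eq_zero]; congr 1
    have hc2 : ((n - 1 - t : ℕ) : ZMod n) = -1 - (t : ZMod n) := by
      rw [Nat.cast_sub (by omega), Nat.cast_sub (by omega), Nat.cast_one, ZMod.natCast_self]
      ring
    rw [hc2]
    ring
  rw [h1, h2, mul_zero, mul_zero, add_zero]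

/-- `slPoly c q` evaluated at `α_w` is `slA c q w`. [this crux] -/
theorem eval_slPoly (α : ZMod n → K) (e : ℕ) (c : ZMod n × Fin 2 × Fin 2 → K)
    (q w : ZMod n) : (slPoly α e c q).eval (α w) = slA α e c q w := by
  unfold slPoly slA slPVal slMulVal
  simp [Polynomial.eval_prod, Fin.sum_univ_two]

/-- `natDegree (slPoly c q) ≤ e + 1`. [this crux] -/
theorem natDegree_slPoly_le (α : ZMod n → K) (e : ℕ) (c : ZMod n × Fin 2 × Fin 2 → K)
    (q : ZMod n) : (slPoly α e c q).natDegree ≤ e + 1 := by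
  unfold slPoly
  have hlin : ∀ a b : K, (Polynomial.C a * Polynomial.X + Polynomial.C b).natDegree ≤ 1 := by
    intro a b
    refine (Polynomial.natDegree_add_le _ _).trans (max_le ?_ ?_)
    · exact (Polynomial.natDegree_C_mul_le _ _).trans Polynomial.natDegree_X_le
    · exact (Polynomial.natDegree_C _).le.trans zero_le_one
  have hprod : ∀ f : ℕ → K,
      (∏ s ∈ Finset.range e, (Polynomial.X - Polynomial.C (f s))).natDegree ≤ e := by
    intro f
    refine (Polynomial.natDegree_prod_le _ _).trans ?_
    refine (Finset.sum_le_sum fun s _ => (Polynomial.natDegree_X_sub_C (f s)).le).trans ?_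
    simp
  refine (Polynomial.natDegree_add_le _ _).trans (max_le ?_ ?_)
  · refine (Polynomial.natDegree_mul_le).trans ?_
    have h1 := hlin (c (q, 0, 0)) (c (q, 0, 1))
    have h2 : (∏ s ∈ Finset.range e, (Polynomial.X -
        Polynomial.C (α (q + s)))).natDegree ≤ e := hprod _
    omega
  · refine (Polynomial.natDegree_mul_le).trans ?_
    have h1 := hlin (c (q, 1, 0)) (c (q, 1, 1))
    have h2 : (∏ s ∈ Finset.range e, (Polynomial.X -
        Polynomial.C (α (q + 2 + s)))).natDegree ≤ e := hprod _
    omega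

/-- **Coefficient extraction**: if `slPoly c q = 0` then the four weights `c (q,0,·)`,
`c (q,1,·)` vanish (evaluate at `α_{q+e}`, `α_{q+e+1}`: roots of `P_{q+2}`, not of `P_q`; then
cancel the nonzero `P_{q+2}`).  Needs `α` injective, `n = e + k + 1`, `2 ≤ e`, `1 ≤ k`.
[this crux] -/
theorem sl_coeff_eq_zero_of_slPoly_eq_zero [NeZero n] {α : ZMod n → K}
    (hα : Function.Injective α) {e k : ℕ} (hn : n = e + k + 1) (he : 2 ≤ e) (hk : 1 ≤ k)
    (c : ZMod n × Fin 2 × Fin 2 → K) (q : ZMod n) (h0 : slPoly α e c q = 0) :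
    c (q, 0, 0) = 0 ∧ c (q, 0, 1) = 0 ∧ c (q, 1, 0) = 0 ∧ c (q, 1, 1) = 0 := by
  set P1 : Polynomial K := ∏ s ∈ Finset.range e,
    (Polynomial.X - Polynomial.C (α (q + s))) with hP1
  set P2 : Polynomial K := ∏ s ∈ Finset.range e,
    (Polynomial.X - Polynomial.C (α (q + 2 + s))) with hP2
  have hpoly : (Polynomial.C (c (q, 0, 0)) * Polynomial.X + Polynomial.C (c (q, 0, 1))) * P1 +
      (Polynomial.C (c (q, 1, 0)) * Polynomial.X + Polynomial.C (c (q, 1, 1))) * P2 = 0 := h0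
  -- `P2` vanishes at `α (q + e + j)`, `j = 0, 1` (index `s = e + j - 2`)
  have hP2root : ∀ j : ℕ, j ≤ 1 → P2.eval (α (q + ((e + j : ℕ) : ZMod n))) = 0 := by
    intro j hj; rw [hP2, Polynomial.eval_prod]
    apply Finset.prod_eq_zero (i := e + j - 2) (Finset.mem_range.mpr (by omega))
    simp only [Polynomial.eval_sub, Polynomial.eval_X, Polynomial.eval_C, sub_eq_zero]
    congr 1
    have hcast : ((e + j - 2 : ℕ) : ZMod n) = ((e + j : ℕ) : ZMod n) - 2 := by
      rw [Nat.cast_sub (by omega)]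
      push_cast
      ring
    rw [hcast]
    ring
  -- `P1` does not vanish at `α (q + e + j)`, `j = 0, 1`
  have hP1ne : ∀ j : ℕ, j ≤ 1 → P1.eval (α (q + ((e + j : ℕ) : ZMod n))) ≠ 0 := by
    intro j hj; rw [hP1, Polynomial.eval_prod]
    refine Finset.prod_ne_zero_iff.mpr fun s hs => ?_
    simp only [Polynomial.eval_sub, Polynomial.eval_X, Polynomial.eval_C, sub_ne_zero]
    intro heq
    have hidx := hα heq
    -- `q + (e + j) = q + s` with `s < e` forces `n ∣ e + j - s`, `0 < e + j - s < n`
    have hs' := Finset.mem_range.mp hs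
    have hcast : (((e + j - s : ℕ) : ZMod n)) = 0 := by
      rw [Nat.cast_sub (by omega)]
      push_cast at hidx ⊢
      linear_combination hidx
    rw [ZMod.natCast_eq_zero_iff] at hcast
    have := Nat.le_of_dvd (by omega) hcast
    omega
  -- evaluate the relation at the two points
  have hev : ∀ j : ℕ, j ≤ 1 →
      c (q, 0, 0) * α (q + ((e + j : ℕ) : ZMod n)) + c (q, 0, 1) = 0 := by
    intro j hj
    have := congrArg (Polynomial.eval (α (q + ((e + j : ℕ) : ZMod n)))) hpoly
    simp only [Polynomial.eval_add, Polynomial.eval_mul, Polynomial.eval_C, Polynomial.eval_X,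
      Polynomial.eval_zero, hP2root j hj, mul_zero, add_zero] at this
    exact (mul_eq_zero.mp this).resolve_right (hP1ne j hj)
  have h00 : c (q, 0, 0) = 0 := by
    have e1 := hev 0 (by norm_num)
    have e2 := hev 1 le_rfl
    have hsub : c (q, 0, 0) *
        (α (q + ((e + 0 : ℕ) : ZMod n)) - α (q + ((e + 1 : ℕ) : ZMod n))) = 0 := by
      linear_combination e1 - e2
    refine (mul_eq_zero.mp hsub).resolve_right ?_
    intro heq
    rw [sub_eq_zero] at heq
    have hidx := hα heq
    have h01 : (((e + 1) - (e + 0) : ℕ) : ZMod n) = 0 := by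
      rw [Nat.cast_sub (by omega)]
      linear_combination -hidx
    rw [ZMod.natCast_eq_zero_iff] at h01
    have := Nat.le_of_dvd (by omega) h01
    omega
  have h01 : c (q, 0, 1) = 0 := by
    have e1 := hev 0 (by norm_num)
    rw [h00, zero_mul, zero_add] at e1
    exact e1
  -- now `(C c10 X + C c11) * P2 = 0` with `P2 ≠ 0`
  have hP2ne : P2 ≠ 0 := by
    rw [hP2]
    exact Finset.prod_ne_zero_iff.mpr fun s _ => Polynomial.X_sub_C_ne_zero _
  have hlin : Polynomial.C (c (q, 1, 0)) * Polynomial.X + Polynomial.C (c (q, 1, 1)) = 0 := by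
    rw [h00, h01] at hpoly
    simp only [map_zero, zero_mul, zero_add] at hpoly
    exact (mul_eq_zero.mp hpoly).resolve_right hP2ne
  have h10 : c (q, 1, 0) = 0 := by
    simpa using congrArg (Polynomial.coeff · 1) hlin
  have h11 : c (q, 1, 1) = 0 := by
    simpa using congrArg (Polynomial.coeff · 0) hlin
  exact ⟨h00, h01, h10, h11⟩

end lemmas

/-- **P4-SIMPLE, Left side.**  For injective `α γ : ZMod n → K`, `n = e + k + 1`, `2 ≤ e`,
`1 ≤ k`: the `4n` products `y_t · P_{q+2o} · R_q` span at least `4n - 2(e+2)` dimensions.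
[this crux; new] -/
theorem sl_finrank_span_ge {K : Type*} [Field K] {n : ℕ} [NeZero n] {α γ : ZMod n → K}
    (hα : Function.Injective α) (hγ : Function.Injective γ) {e k : ℕ} (hn : n = e + k + 1)
    (he : 2 ≤ e) (hk : 1 ≤ k) :
    4 * n - 2 * (e + 2) ≤ Module.finrank K ↥(Submodule.span K (Set.range (slGen α γ e k))) := by
  classical
  set Ψ := Fintype.linearCombination K (slGen α γ e k) with hΨ
  have hrange : LinearMap.range Ψ = Submodule.span K (Set.range (slGen α γ e k)) :=
    Fintype.range_linearCombination K _
  have hee : e + 2 ≤ n := by omega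
  let pt : Fin (e + 2) → ZMod n := fun i => ((i : ℕ) : ZMod n)
  have hpt : Function.Injective pt := by
    intro i j hij
    have hi := i.isLt; have hj := j.isLt
    have h1 : (((i : ℕ) : ZMod n)).val = (((j : ℕ) : ZMod n)).val := by
      change (pt i).val = (pt j).val
      rw [hij]
    rw [ZMod.val_natCast, ZMod.val_natCast, Nat.mod_eq_of_lt (by omega),
      Nat.mod_eq_of_lt (by omega)] at h1
    exact Fin.ext h1
  let Θ : (LinearMap.ker Ψ) →ₗ[K] (Fin (e + 2) × Fin 2 → K) :=
    { toFun := fun c ij =>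
        slA α e (c : ZMod n × Fin 2 × Fin 2 → K) (pt ij.1 + (k : ZMod n) + ((ij.2 : ℕ) : ZMod n))
          (pt ij.1)
      map_add' := by
        intro c d; funext ij
        simp only [Submodule.coe_add, Pi.add_apply]
        exact slA_add α e _ _ _ _
      map_smul' := by
        intro r c; funext ij
        simp only [Submodule.coe_smul, Pi.smul_apply, smul_eq_mul, RingHom.id_apply]
        exact slA_smul α e r _ _ _ }
  have hΘ : Function.Injective Θ := by
    rw [← LinearMap.ker_eq_bot, LinearMap.ker_eq_bot']
    intro c hc
    obtain ⟨c, hcker⟩ := c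
    have hrel : Ψ c = 0 := hcker
    -- step 1: for each recorded point `w = pt i`, all coefficients `slA c q w` vanish
    have hall : ∀ i : Fin (e + 2), ∀ q : ZMod n, slA α e c q (pt i) = 0 := by
      intro i
      -- the substituted relation, reindexed by the window start `p = q + (e+1)`
      have hv : ∑ p : ZMod n, slA α e c (p - ((e + 1 : ℕ) : ZMod n)) (pt i) •
          swW γ (2 : Fin 4) 3 k p = 0 := by
        have h0 : ∑ q : ZMod n, slA α e c q (pt i) •
            swW γ (2 : Fin 4) 3 k (q + ((e + 1 : ℕ) : ZMod n)) = 0 := by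
          rw [← slEv_linearCombination α γ e k (pt i) c]
          change slEv α (pt i) (Ψ c) = 0
          rw [hrel, map_zero]
        rw [← h0]
        exact (Fintype.sum_equiv (Equiv.addRight (((e + 1 : ℕ) : ZMod n))) _ _ fun q => by
          simp only [Equiv.coe_addRight, add_sub_cancel_right]).symm
      have h23 : (2 : Fin 4) ≠ 3 := by decide
      have hzero := sw_coeff_eq_zero_of_sum_eq_zero_of_top_two hγ h23 (e := k) (by omega)
        (pt i - 1 + ((e + 1 : ℕ) : ZMod n))
        (fun p => slA α e c (p - ((e + 1 : ℕ) : ZMod n)) (pt i)) ?_ hv ?_ ?_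
      · intro q
        have := congrFun hzero (q + ((e + 1 : ℕ) : ZMod n))
        simpa only [add_sub_cancel_right, Pi.zero_apply] using this
      · intro p hp
        obtain ⟨t, ht, hpt'⟩ := slA_support α hn c (pt i) _ hp
        refine ⟨t, ht, ?_⟩
        have : p = p - ((e + 1 : ℕ) : ZMod n) + ((e + 1 : ℕ) : ZMod n) := by ring
        rw [this, hpt']
        ring
      · have := congrFun hc (i, 0)
        simp only [Θ, LinearMap.coe_mk, AddHom.coe_mk, Pi.zero_apply] at this
        convert this using 2
        simp only [Fin.val_zero, Nat.cast_zero, Nat.cast_add, Nat.cast_one, add_zero]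
        ring
      · have := congrFun hc (i, 1)
        simp only [Θ, LinearMap.coe_mk, AddHom.coe_mk, Pi.zero_apply] at this
        convert this using 2
        simp only [Fin.val_one, Nat.cast_one, Nat.cast_add, Nat.cast_ofNat]
        ring
    -- step 2: each slPoly c q vanishes at e+2 distinct points, hence is zero
    have hpoly : ∀ q : ZMod n, slPoly α e c q = 0 := by
      intro q
      refine Polynomial.eq_zero_of_natDegree_lt_card_of_eval_eq_zero _ (hα.comp hpt)
        (fun i => ?_) ?_
      · rw [Function.comp_apply, eval_slPoly]; exact hall i q
      · simp only [Fintype.card_fin]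
        exact Nat.lt_succ_of_le (natDegree_slPoly_le α e c q)
    -- step 3: all weights vanish
    apply Subtype.ext
    funext ⟨q, o, t⟩
    simp only [Submodule.coe_zero, Pi.zero_apply]
    have h := sl_coeff_eq_zero_of_slPoly_eq_zero hα hn he hk c q (hpoly q)
    fin_cases o <;> fin_cases t
    · exact h.1
    · exact h.2.1
    · exact h.2.2.1
    · exact h.2.2.2
  have hker : Module.finrank K (LinearMap.ker Ψ) ≤ 2 * (e + 2) := by
    have := LinearMap.finrank_le_finrank_of_injective hΘ
    rw [Module.finrank_fintype_fun_eq_card, Fintype.card_prod, Fintype.card_fin,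
      Fintype.card_fin] at this
    linarith
  have hrn := LinearMap.finrank_range_add_finrank_ker Ψ
  rw [Module.finrank_fintype_fun_eq_card, Fintype.card_prod, Fintype.card_prod, ZMod.card,
    Fintype.card_fin] at hrn
  rw [← hrange]
  omega

end

end Summit.ValiantsHypothesis.ValiantsHypothesis.Theorems.ValuativeFlip
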